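import Summits.BirchSwinnertonDyer.Rank1Residual.Supersingular.SignedRankOneLinkBKO
import Summits.BirchSwinnertonDyer.Rank1Residual.Supersingular.KobayashiMainConjectureX7
import Literature.NumberTheory.EllipticCurves.BurungaleKobayashiOta2024.RankOnePPartOfMainConjecture
import HarnessLib

/-!
# The rank-one link at a good supersingular prime with `a_p = 0` as a NAMED published fact:
# Burungale–Kobayashi–Ota 2024 Cor. A.5 ∘ Kobayashi 2003 Thm. 7.4 — the MAIN-CONJECTURE-LEVEL row
# theorem for the `a_p = 0` rank-one supersingular axis (X6/X7 ∩ {r_an = 1}) and the certificate-fed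
# per-pair theorems of `SignedRankOneLinkBKO` with NO displayed binder (cell `b2b-bsdres`,
# supersingular family, prover B = unit `b2b-bsdres-additive-p3`, gen 13; X7 joint with prover A)

HONEST FRAMING (run/shared/lean/b2b/bsd-rank1-residual/, verbatim in every file): the goal of the
cell is to DELETE the COMBINATION-SHAPED residual classes of the Birch–Swinnerton-Dyer formula for
ALL analytic-rank `≤ 1` elliptic curves over `ℚ` — "full BSD formula for every rank `≤ 1` curve in
class `C`" assembled STRICTLY from published theorems — so that the rank-`≤ 1` remainder becomes
exactly the CONSTRUCTION-SHAPED classes, which are TYPED (missing-input `Prop`s), NOT attempted.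
This is not "finishing BSD". Classes X6 (`ss(p) ∧ sst ∧ (p ≥ 5 ∨ a_3 = 0)`), X7 (`ss(p) ∧ ¬sst`) and
X8 (`p = 3`, `a_3 = ±3`) stay CONSTRUCTION-SHAPED; no label is moved; nothing is booked (the referee
rules, the lane books); nothing about any particular curve is asserted. Theorems only (pure
compositions); no definition; the ONE named fact consumed that is new is the Literature reading-fact
`BurungaleKobayashiOta2024.corA5_pPart_of_signedCharIdeal_eq` (BKO, J. Inst. Math. Jussieu 23
(2024) App. A Cor. A.5, read at `a_p = 0` through Kobayashi, Invent. Math. 152 (2003) Thm. 7.4;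
referee R118 §C.5 flags `BKO24-CorA5-IMC-unpinned`, `BKO24-CorA5-proof-by-reference-Kob14` carried by
the fact) — it REPLACES the displayed binder `hBKO : KobayashiMainConjecture W p ε → MissingPPartAt W p`
of `SignedRankOneLinkBKO.lean` (p238125) for `a_p = 0`.

## What this file proves (all class-agnostic in `a_p = 0`, then specialised to X7 / X6)

1. `kobayashiMainConjecture_iff_corA5Hypothesis` — the cell's typed input
   `KobayashiMainConjecture W p ε` (prover A, p209365) IS, by `Iff.rfl`, the hypothesis of the fact
   (the fact spells the two Summits-side abbreviations `IsPollackPair`, `kobayashiL` out).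
2. `pPart_of_kobayashiMainConjecture_of_corA5`, `missingPPartAt_of_kobayashiMainConjecture_of_corA5`
   — odd good `p`, `a_p = 0`, `r_an = 1`: the signed main conjecture for ONE sign gives the print shape
   `PPart W p` (the fact) and hence the typed output `MissingPPartAt W p` (modularity `hmod` for
   `L'(E,1) ≠ 0`, GZK `hGZK`): THIS IS the binder `hBKO` of p238125, now a theorem under the fact.
3. **MC-LEVEL ROW THEOREM** `bsdp_of_kobayashiMainConjecture_of_corA5_of_analyticRank_eq_one`: for
   `W/ℚ` globally minimal, `p` odd of good reduction with `a_p = 0`, `ord_{s=1}L(E,s) = 1`: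
   `KobayashiMainConjecture W p ε` (ONE typed input) + the fact + modularity + GZK ⇒ `BSDp W p` — the
   shape the glue seat used for the covered rows (`Partition/MainConjectures.lean`: BSD_p ⇐ named facts
   + ONE main-conjecture input), now available for the good-supersingular `a_p = 0` RANK-ONE axis
   (RESIDUAL-MAP §B: X6 r = 1 "COVERED [PUB\*] JSW-ss" gets a flag-free-modulo-(Kob) second reading;
   X7 r = 1 "NEEDS X_B2" becomes NEEDS X_B2 + [PUB] Cor. A.5, level-free and route-independent).
   Specialisations `X7.…` (with `a_p = 0` a hypothesis at `p = 3`, automatic at `p ≥ 5`: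
   `X7.…_of_five_le`) and `X6.…` (`a_p = 0` automatic at odd `p`).
4. **PER PAIR, NO DISPLAYED BINDER**: `bsdp_of_mazurTate_odd/even_of_corA5_of_analyticRank_eq_one`,
   `X7.bsdp_of_mazurTate_odd/even_of_corA5_…`, `X7.bsdp_of_lam_eq_one_of_corA5_…`,
   `X6.bsdp_of_lam_eq_one_of_corA5_…`: at a rank-one pair with `ρ̄_{E,p}` onto, ONE Mazur–Tate
   certificate (`Θ ≠ 0`, `ι Θ = θ_n`, `μ(Θ) = 0`, `λ(Θ) = q_n + 1 < pⁿ`; two engines of the census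
   seats) or the λ-certificate `(μ,λ)(L_p^ε) = (0,1)` gives `KobayashiMainConjecture W p ε` AT THE PAIR
   from named published facts (Kobayashi 2003 Thms. 1.2/4.1 = A94/A98, the period-unit facts, Wuthrich
   2014 Lemma 20, GZK; `KobayashiSqueezeReal` p213197, `SqueezeCertificates` p214698) and the fact
   turns it into `BSD(E,p)`. So for these pairs EVERY input is a named published fact or a kernel-
   checked certificate. Census reach (HOME/b2b-bsdres-additive-p3/g12/tight_r1_two_engine_keys.json;
   iw-2 ENGINE T = engine B): X7 ∩ {r_an = 1}: 31 of 72 window pairs (`N < 2·10⁴`) + 1 221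
   beyond-window pairs (`N < 5·10⁵`; p = 3: 274, 5: 271, 7: 248, 11: 372, 13: 56) two-engine tight.
   NOT booked here; the referee rules on admissibility (standard R-X6-KUR / R183.5).

What is NOT claimed: X8 (`a_3 = ±3`) keeps the displayed binder (no ♯/♭ Selmer objects; p238125);
no main conjecture is asserted anywhere; the fact is a READING (two flags) and adds `+1` to the
cell's named-fact debt while retiring a displayed binder of the same content.

References: [BurungaleKobayashiOta2023] App. A Cor. A.5 (Cor. A.3, A.4, Thm. A.6); [Kobayashi2003]
Thm. 7.4 (p. 13), Conjecture (p. 2), Thms. 1.2, 4.1; [Pollack2003] Props. 6.9, 6.10, 6.18;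
[Wuthrich2014] Lemma 20 (p. 399); [GreenbergVatsal2000] p. 4; [Miller2011LMS] §1, Def. 1.1;
[YanZhu2026] Thm. 4.15 (print shape); [Darmon2004] Thm. 3.22 (GZK).
-/

set_option autoImplicit false

noncomputable section

open scoped Classical MatrixGroups ModularForm

open CongruenceSubgroup WeierstrassCurve Literature.NumberTheory.EllipticCurves
  Literature.NumberTheory.EllipticCurves.ModularForms
  Literature.NumberTheory.EllipticCurves.Rank1Residual
  Literature.NumberTheory.EllipticCurves.Rank1Residual.Typed
  Literature.NumberTheory.EllipticCurves.Kobayashi2003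
  Literature.NumberTheory.EllipticCurves.BurungaleKobayashiOta2024 ZpExtension
  Summit.BirchSwinnertonDyer.Rank1Residual.X1.MuLambda

namespace Summit.BirchSwinnertonDyer.Rank1Residual.Supersingular

variable (W : WeierstrassCurve ℚ) [W.IsElliptic] [W.IsGloballyMinimal] (p : ℕ) [Fact p.Prime]

/-! ### The cell's typed input is the hypothesis of the fact -/

section Bridge

/-- **Bridge (definitional).** The cell's typed input `KobayashiMainConjecture W p ε` (Kobayashi's
signed main conjecture for `(E, p, ε)`, Néron normalisation; prover A, p209365) is — with its two
Summits-side abbreviations `IsPollackPair f p L⁺ L⁻` (both non-zero + Pollack's congruences) and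
`kobayashiL ε L⁺ L⁻ = if ε = 1 then L⁻ else L⁺` unfolded — LITERALLY the hypothesis of the Literature
fact `corA5_pPart_of_signedCharIdeal_eq`; `Iff.rfl`. [cite: Kobayashi2003, Conjecture (Main Conjecture) (p. 2) and (3.6) (p. 7)]
[cite: Pollack2003, Thm. 5.6, Cor. 5.11 and Prop. 6.18] -/
theorem kobayashiMainConjecture_iff_corA5Hypothesis (ε : ℤˣ) :
    KobayashiMainConjecture W p ε ↔
    (∀ (κ : ZpExtension ℚ p) (γ : Field.absoluteGaloisGroup ℚ),
        κ.IsCyclotomic → κ.IsTopGenerator γ → IsCyclotomicVariable p γ →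
      ∀ [NeZero (W.conductorNorm ℤ)] (f : CuspForm (Gamma0 (W.conductorNorm ℤ)) 2),
        IsNewformOf W f → ∀ (ϖ : ℚ), (ϖ : ℝ) * W.realPeriodRat = plusPeriod f →
      ∀ (Lplus Lminus : IwasawaAlgebra p),
        (Lplus ≠ 0 ∧ Lminus ≠ 0 ∧
          (∀ n : ℕ, Odd n →
            IsCongrModOmega p n (mazurTateElement f p n)
              ((-1) ^ (n / 2 + 1) * cyclotomicOmegaPlus p n) Lplus) ∧
          (∀ n : ℕ, Even n →
            IsCongrModOmega p n (mazurTateElement f p n)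
              ((-1) ^ (n / 2 + 1) * cyclotomicOmegaMinus p n) Lminus)) →
      ∀ (D : SignedSelmerDualData W κ γ ε), Module.IsTorsion (IwasawaAlgebra p) D.X ∧
        ∃ g : IwasawaAlgebra p, D.charIdeal = Ideal.span {g} ∧
          iwasawaToPowerSeries p g =
            PowerSeries.C (ϖ : ℚ_[p]) *
              iwasawaToPowerSeries p (if ε = 1 then Lminus else Lplus)) :=
  Iff.rfl

end Bridge

/-! ### The rank-one link as a theorem under the fact (odd good `p`, `a_p = 0`) -/

section Link

/-- **Cor. A.5 (a_p = 0 reading): the signed main conjecture for one sign ⇒ the print shape of the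
`p`-part of BSD** at an odd good prime `p` with `a_p = 0` and `ord_{s=1}L(E,s) = 1`. The fact applied
to the cell's typed input (definitional bridge). [cite: BurungaleKobayashiOta2023, App. A Cor. A.5]
[cite: Kobayashi2003, Thm. 7.4 (p. 13)] -/
theorem pPart_of_kobayashiMainConjecture_of_corA5 (hA5 : corA5_pPart_of_signedCharIdeal_eq)
    (hp : p ≠ 2) (hgood : W.HasGoodReductionAtPrime p) (hap : W.frobeniusTrace p = 0)
    (h1 : W.analyticRank = 1) (ε : ℤˣ) (hMC : KobayashiMainConjecture W p ε) : PPart W p :=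
  hA5 W p ε hp hgood hap h1 ((kobayashiMainConjecture_iff_corA5Hypothesis W p ε).mp hMC)

/-- **The displayed binder `hBKO` of `SignedRankOneLinkBKO` (p238125) DISCHARGED under the fact**:
odd good `p`, `a_p = 0`, `ord_{s=1}L(E,s) = 1`: `KobayashiMainConjecture W p ε → MissingPPartAt W p`
(print shape ⇒ typed output: modularity `hmod` for `L'(E,1) ≠ 0`, GZK `hGZK` for finiteness of `Ш`;
`missingPPartAt_of_pPart`). [cite: BurungaleKobayashiOta2023, App. A Cor. A.5]
[cite: Kobayashi2003, Thm. 7.4 (p. 13)] [cite: Miller2011LMS, §1 and Def. 1.1] [cite: Darmon2004, Thm. 3.22] -/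
theorem missingPPartAt_of_kobayashiMainConjecture_of_corA5
    (hA5 : corA5_pPart_of_signedCharIdeal_eq) (hmod : hasEntireLFunction_rat)
    (hGZK : rank_eq_analyticRank_of_analyticRank_le_one)
    (hp : p ≠ 2) (hgood : W.HasGoodReductionAtPrime p) (hap : W.frobeniusTrace p = 0)
    (h1 : W.analyticRank = 1) (ε : ℤˣ) :
    KobayashiMainConjecture W p ε → MissingPPartAt W p := fun hMC ↦
  missingPPartAt_of_pPart W p hmod hGZK h1.le
    (pPart_of_kobayashiMainConjecture_of_corA5 W p hA5 hp hgood hap h1 ε hMC)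

/-- **MAIN-CONJECTURE-LEVEL ROW THEOREM for the good-supersingular `a_p = 0` rank-one axis.** For a
globally minimal `W/ℚ`, an odd prime `p` of good reduction with `a_p = 0` (supersingular), and
`ord_{s=1}L(E,s) = 1`: Kobayashi's signed main conjecture for ONE sign `ε` at `(E, p)` — the cell's
typed input `KobayashiMainConjecture W p ε` — gives Miller's `BSD(E,p)`, granted BY NAME the
Burungale–Kobayashi–Ota Cor. A.5 reading-fact `hA5`, modularity `hmod` and GZK `hGZK`. No image,
semistability, level or Heegner hypothesis (Cor. A.5 is level-free; the imaginary quadratic field is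
chosen inside its proof by Bump–Friedberg–Hoffstein). Class-agnostic (X6 ∪ X7 ∩ {a_p = 0});
nothing asserted beyond the binders. [cite: BurungaleKobayashiOta2023, App. A Cor. A.5 and Thm. A.6]
[cite: Kobayashi2003, Thm. 7.4 (p. 13) and Conjecture (p. 2)] [cite: Miller2011LMS, §1 and Def. 1.1] [cite: Darmon2004, Thm. 3.22] -/
theorem bsdp_of_kobayashiMainConjecture_of_corA5_of_analyticRank_eq_one
    (hA5 : corA5_pPart_of_signedCharIdeal_eq) (hmod : hasEntireLFunction_rat)
    (hGZK : rank_eq_analyticRank_of_analyticRank_le_one)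
    (hp : p ≠ 2) (hgood : W.HasGoodReductionAtPrime p) (hap : W.frobeniusTrace p = 0)
    (h1 : W.analyticRank = 1) (ε : ℤˣ) (hMC : KobayashiMainConjecture W p ε) : BSDp W p :=
  bsdp_of_pPart W p hmod hGZK h1.le (pPart_of_kobayashiMainConjecture_of_corA5 W p hA5 hp hgood hap h1 ε hMC)

/-- **X7 ∩ {r_an = 1}, odd `p`, `a_p = 0`: `BSD(E,p)` ⇐ ONE typed input `KobayashiMainConjecture W p ε`**
(+ the Cor. A.5 reading-fact, modularity, GZK by name). Good reduction is part of class X7; `a_p = 0`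
is a hypothesis at `p = 3` (the `a_3 = ±3` pairs are class X8) and automatic at `p ≥ 5`
(`X7.bsdp_of_kobayashiMainConjecture_of_corA5_of_analyticRank_eq_one_of_five_le`). X7 stays
CONSTRUCTION-SHAPED: the typed input is Kobayashi's main conjecture at a NON-semistable curve, in
print as a conjecture only (BSTW Thm. 1.3 is semistable and a preprint). [cite: BurungaleKobayashiOta2023, App. A Cor. A.5]
[cite: Kobayashi2003, Thm. 7.4 (p. 13) and Conjecture (p. 2)] [cite: Miller2011LMS, §1 and Def. 1.1] -/
theorem X7.bsdp_of_kobayashiMainConjecture_of_corA5_of_analyticRank_eq_one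
    (hA5 : corA5_pPart_of_signedCharIdeal_eq) (hmod : hasEntireLFunction_rat)
    (hGZK : rank_eq_analyticRank_of_analyticRank_le_one)
    (hp : p ≠ 2) (hX : ClassX7 W p) (hap : W.frobeniusTrace p = 0)
    (h1 : W.analyticRank = 1) (ε : ℤˣ) (hMC : KobayashiMainConjecture W p ε) : BSDp W p :=
  _root_.Summit.BirchSwinnertonDyer.Rank1Residual.Supersingular.bsdp_of_kobayashiMainConjecture_of_corA5_of_analyticRank_eq_one
    W p hA5 hmod hGZK hp hX.1.1 hap h1 ε hMC

/-- **X7 ∩ {r_an = 1}, `p ≥ 5`: `BSD(E,p)` ⇐ ONE typed input `KobayashiMainConjecture W p ε`**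
(`a_p = 0` by Hasse, `ClassX7.frobeniusTrace_eq_zero_of_five_le`). [cite: BurungaleKobayashiOta2023, App. A Cor. A.5]
[cite: Kobayashi2003, Thm. 7.4 (p. 13) and Conjecture (p. 2)] [cite: Serre1981, §8.1–8.2 (pp. 188–189)] -/
theorem X7.bsdp_of_kobayashiMainConjecture_of_corA5_of_analyticRank_eq_one_of_five_le
    (hA5 : corA5_pPart_of_signedCharIdeal_eq) (hmod : hasEntireLFunction_rat)
    (hGZK : rank_eq_analyticRank_of_analyticRank_le_one)
    (hp5 : 5 ≤ p) (hX : ClassX7 W p) (h1 : W.analyticRank = 1) (ε : ℤˣ)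
    (hMC : KobayashiMainConjecture W p ε) : BSDp W p :=
  _root_.Summit.BirchSwinnertonDyer.Rank1Residual.Supersingular.bsdp_of_kobayashiMainConjecture_of_corA5_of_analyticRank_eq_one
    W p hA5 hmod hGZK (by omega) hX.1.1 (ClassX7.frobeniusTrace_eq_zero_of_five_le W p hp5 hX) h1 ε hMC

/-- **X6 ∩ {r_an = 1}, odd `p`: `BSD(E,p)` ⇐ ONE typed input `KobayashiMainConjecture W p ε`**
(`a_p = 0` automatic on class X6 at an odd prime, `ClassX6.frobeniusTrace_eq_zero`). A second reading
of the cell beside JSW 2017 Thm. 1.2.1 (flag `JSW-ss`): here the only non-refereed content is the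
typed input itself (announced for semistable `E`: BSTW Thm. 1.3, PRE — `X6.bsdp_of_BSTW13_OPEN_…` is
NOT restated here). [cite: BurungaleKobayashiOta2023, App. A Cor. A.5] [cite: Kobayashi2003, Thm. 7.4 (p. 13) and Conjecture (p. 2)]
[cite: Serre1981, §8.1–8.2 (pp. 188–189)] -/
theorem X6.bsdp_of_kobayashiMainConjecture_of_corA5_of_analyticRank_eq_one
    (hA5 : corA5_pPart_of_signedCharIdeal_eq) (hmod : hasEntireLFunction_rat)
    (hGZK : rank_eq_analyticRank_of_analyticRank_le_one)
    (hp : p ≠ 2) (hX : ClassX6 W p) (h1 : W.analyticRank = 1) (ε : ℤˣ)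
    (hMC : KobayashiMainConjecture W p ε) : BSDp W p :=
  _root_.Summit.BirchSwinnertonDyer.Rank1Residual.Supersingular.bsdp_of_kobayashiMainConjecture_of_corA5_of_analyticRank_eq_one
    W p hA5 hmod hGZK hp hX.1.1 (ClassX6.frobeniusTrace_eq_zero W p hp hX) h1 ε hMC

/-- **X6 ∩ {r_an = 1} under the ANNOUNCED BSTW Thm. 1.3 (OPEN hypothesis, preprint) and the Cor. A.5
fact**: the kernel referees "BSTW Thm. 1.3 ⇒ BSD_p in rank one" for semistable `E` at an odd
supersingular `p` — granted the announced main conjecture, the rank-one `p`-part follows from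
PUBLISHED results only (Cor. A.5 ∘ Kobayashi Thm. 7.4, modularity, GZK). NEVER cite
`BurungaleSkinnerTianWan2024_thm13_OPEN` as a theorem. [claim: BurungaleSkinnerTianWan2024, status: under-review]
[cite: BurungaleKobayashiOta2023, App. A Cor. A.5] [cite: Kobayashi2003, Thm. 7.4 (p. 13)] -/
theorem X6.bsdp_of_BSTW13_OPEN_of_corA5_of_analyticRank_eq_one
    (hBSTW : BurungaleSkinnerTianWan2024_thm13_OPEN)
    (hA5 : corA5_pPart_of_signedCharIdeal_eq) (hmod : hasEntireLFunction_rat)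
    (hGZK : rank_eq_analyticRank_of_analyticRank_le_one)
    (hp : p ≠ 2) (hX : ClassX6 W p) (h1 : W.analyticRank = 1) : BSDp W p :=
  X6.bsdp_of_kobayashiMainConjecture_of_corA5_of_analyticRank_eq_one W p hA5 hmod hGZK hp hX h1 1
    (hBSTW W p hp hX.2.1 hX.1 (fun h3 ↦ by subst h3; exact ClassX6.frobeniusTrace_eq_zero W 3 hp hX) 1)

end Link

/-! ### PER PAIR: one Mazur–Tate certificate ⇒ `BSD(E,p)`, every other input a named fact -/

section PerPair

/-- **`a_p = 0`, odd good `p`, `ρ̄_{E,p}` onto, `r_an = 1`, sign `ε = −1` (the tree's `L⁺`, odd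
levels): `BSD(E,p)` from ONE odd-level Mazur–Tate certificate, every other input a NAMED published
fact.** `bsdp_of_mazurTate_odd_of_bkoLink_of_analyticRank_eq_one` (p238125) with its displayed
binder `hBKO` supplied by `missingPPartAt_of_kobayashiMainConjecture_of_corA5`: Kobayashi Thms.
1.2/4.1 (`h12`/`h41` = A94/A98), period-unit facts `h5`/`h3`, Wuthrich Lemma 20 `hL20`, GZK `hGZK`,
modularity `hmod`, the Cor. A.5 reading-fact `hA5`; certificate: `Θ ≠ 0`, `ι Θ = θ_n` for the
newform `f₀` of level `N_E`, `n` odd, `μ(Θ) = 0`, `λ(Θ) = deg ω_n^+ + 1 < pⁿ`. Class-agnostic;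
PER PAIR; nothing booked. [cite: BurungaleKobayashiOta2023, App. A Cor. A.5]
[cite: Kobayashi2003, Thm. 7.4, Thm. 1.2, Thm. 4.1 and Conjecture (p. 2)] [cite: Pollack2003, Prop. 6.9, 6.10 and 6.18]
[cite: Wuthrich2014, Lemma 20 (p. 399)] [cite: Miller2011LMS, §1 and Def. 1.1] -/
theorem bsdp_of_mazurTate_odd_of_corA5_of_analyticRank_eq_one
    (h12 : Kobayashi2003.thm12_signedSelmerDual_finite_torsion)
    (h41 : Kobayashi2003.thm41_signedCharIdeal_divisibility)
    (h5 : realPeriodRat_eq_unit_mul_plusPeriod) (h3 : realPeriodRat_eq_unit_mul_plusPeriod_three)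
    (hL20 : Wuthrich2014.lemma20_surjective_threeAdic_of_semistable)
    (hGZK : rank_eq_analyticRank_of_analyticRank_le_one) (hmod : hasEntireLFunction_rat)
    (hA5 : corA5_pPart_of_signedCharIdeal_eq)
    (hp : p ≠ 2) (hgood : W.HasGoodReductionAtPrime p) (hap : W.frobeniusTrace p = 0)
    (hs : Surj W p) (h1 : W.analyticRank = 1)
    [NeZero (W.conductorNorm ℤ)] {f₀ : CuspForm (Gamma0 (W.conductorNorm ℤ)) 2} (hf₀ : IsNewformOf W f₀)
    {n : ℕ} (hn : Odd n) {Θ : IwasawaAlgebra p}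
    (hΘ : iwasawaToPowerSeries p Θ =
      ((mazurTateElement f₀ p n).map (algebraMap ℚ ℚ_[p]) : PowerSeries ℚ_[p]))
    (hΘ0 : Θ ≠ 0) (hμ : mu Θ = 0) (hlam : lam Θ = (cyclotomicOmegaPlus p n).natDegree + 1)
    (hlt : lam Θ < p ^ n) : BSDp W p :=
  bsdp_of_mazurTate_odd_of_bkoLink_of_analyticRank_eq_one W p h12 h41 h5 h3 hL20 hGZK hp hgood hap hs h1
    hf₀ hn hΘ hΘ0 hμ hlam hlt
    (missingPPartAt_of_kobayashiMainConjecture_of_corA5 W p hA5 hmod hGZK hp hgood hap h1 (-1))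

/-- **`a_p = 0`, odd good `p`, `ρ̄_{E,p}` onto, `r_an = 1`, sign `ε = 1` (the tree's `L⁻`, even
levels): `BSD(E,p)` from ONE even-level Mazur–Tate certificate (`n` even, `λ(Θ) = deg ω_n^- + 1 < pⁿ`),
every other input a named fact.** PER PAIR. [cite: BurungaleKobayashiOta2023, App. A Cor. A.5]
[cite: Kobayashi2003, Thm. 7.4, Thm. 1.2, Thm. 4.1 and Conjecture (p. 2)] [cite: Pollack2003, Prop. 6.9, 6.10 and 6.18]
[cite: Wuthrich2014, Lemma 20 (p. 399)] [cite: Miller2011LMS, §1 and Def. 1.1] -/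
theorem bsdp_of_mazurTate_even_of_corA5_of_analyticRank_eq_one
    (h12 : Kobayashi2003.thm12_signedSelmerDual_finite_torsion)
    (h41 : Kobayashi2003.thm41_signedCharIdeal_divisibility)
    (h5 : realPeriodRat_eq_unit_mul_plusPeriod) (h3 : realPeriodRat_eq_unit_mul_plusPeriod_three)
    (hL20 : Wuthrich2014.lemma20_surjective_threeAdic_of_semistable)
    (hGZK : rank_eq_analyticRank_of_analyticRank_le_one) (hmod : hasEntireLFunction_rat)
    (hA5 : corA5_pPart_of_signedCharIdeal_eq)
    (hp : p ≠ 2) (hgood : W.HasGoodReductionAtPrime p) (hap : W.frobeniusTrace p = 0)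
    (hs : Surj W p) (h1 : W.analyticRank = 1)
    [NeZero (W.conductorNorm ℤ)] {f₀ : CuspForm (Gamma0 (W.conductorNorm ℤ)) 2} (hf₀ : IsNewformOf W f₀)
    {n : ℕ} (hn : Even n) {Θ : IwasawaAlgebra p}
    (hΘ : iwasawaToPowerSeries p Θ =
      ((mazurTateElement f₀ p n).map (algebraMap ℚ ℚ_[p]) : PowerSeries ℚ_[p]))
    (hΘ0 : Θ ≠ 0) (hμ : mu Θ = 0) (hlam : lam Θ = (cyclotomicOmegaMinus p n).natDegree + 1)
    (hlt : lam Θ < p ^ n) : BSDp W p :=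
  bsdp_of_mazurTate_even_of_bkoLink_of_analyticRank_eq_one W p h12 h41 h5 h3 hL20 hGZK hp hgood hap hs h1
    hf₀ hn hΘ hΘ0 hμ hlam hlt
    (missingPPartAt_of_kobayashiMainConjecture_of_corA5 W p hA5 hmod hGZK hp hgood hap h1 1)

/-- **X7 ∧ `r_an = 1` ∧ odd `p` ∧ `a_p = 0` ∧ surj(p), sign `ε = −1`: `BSD(E,p)` from ONE odd-level
Mazur–Tate certificate, every other input a named fact** (the displayed `hBKO` of
`X7.bsdp_of_mazurTate_odd_of_bkoLink_…`, p238125, supplied by the Cor. A.5 reading-fact). Census: 31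
of the 72 window X7 rank-one pairs and 1 221 beyond-window pairs (`N < 5·10⁵`) are two-engine tight
for some sign. PER PAIR; X7 stays CONSTRUCTION-SHAPED; nothing booked. [cite: BurungaleKobayashiOta2023, App. A Cor. A.5]
[cite: Kobayashi2003, Thm. 7.4, Thm. 1.2, Thm. 4.1 and Conjecture (p. 2)] [cite: Wuthrich2014, Lemma 20 (p. 399)]
[cite: Miller2011LMS, §1 and Def. 1.1] -/
theorem X7.bsdp_of_mazurTate_odd_of_corA5_of_analyticRank_eq_one
    (h12 : Kobayashi2003.thm12_signedSelmerDual_finite_torsion)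
    (h41 : Kobayashi2003.thm41_signedCharIdeal_divisibility)
    (h5 : realPeriodRat_eq_unit_mul_plusPeriod) (h3 : realPeriodRat_eq_unit_mul_plusPeriod_three)
    (hL20 : Wuthrich2014.lemma20_surjective_threeAdic_of_semistable)
    (hGZK : rank_eq_analyticRank_of_analyticRank_le_one) (hmod : hasEntireLFunction_rat)
    (hA5 : corA5_pPart_of_signedCharIdeal_eq)
    (hp : p ≠ 2) (hX : ClassX7 W p) (hap : W.frobeniusTrace p = 0) (hs : Surj W p)
    (h1 : W.analyticRank = 1)
    [NeZero (W.conductorNorm ℤ)] {f₀ : CuspForm (Gamma0 (W.conductorNorm ℤ)) 2} (hf₀ : IsNewformOf W f₀)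
    {n : ℕ} (hn : Odd n) {Θ : IwasawaAlgebra p}
    (hΘ : iwasawaToPowerSeries p Θ =
      ((mazurTateElement f₀ p n).map (algebraMap ℚ ℚ_[p]) : PowerSeries ℚ_[p]))
    (hΘ0 : Θ ≠ 0) (hμ : mu Θ = 0) (hlam : lam Θ = (cyclotomicOmegaPlus p n).natDegree + 1)
    (hlt : lam Θ < p ^ n) : BSDp W p :=
  _root_.Summit.BirchSwinnertonDyer.Rank1Residual.Supersingular.bsdp_of_mazurTate_odd_of_corA5_of_analyticRank_eq_one
    W p h12 h41 h5 h3 hL20 hGZK hmod hA5 hp hX.1.1 hap hs h1 hf₀ hn hΘ hΘ0 hμ hlam hlt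

/-- **X7 ∧ `r_an = 1` ∧ odd `p` ∧ `a_p = 0` ∧ surj(p), sign `ε = 1`: `BSD(E,p)` from ONE even-level
Mazur–Tate certificate, every other input a named fact.** PER PAIR; nothing booked.
[cite: BurungaleKobayashiOta2023, App. A Cor. A.5] [cite: Kobayashi2003, Thm. 7.4, Thm. 1.2, Thm. 4.1 and Conjecture (p. 2)]
[cite: Wuthrich2014, Lemma 20 (p. 399)] [cite: Miller2011LMS, §1 and Def. 1.1] -/
theorem X7.bsdp_of_mazurTate_even_of_corA5_of_analyticRank_eq_one
    (h12 : Kobayashi2003.thm12_signedSelmerDual_finite_torsion)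
    (h41 : Kobayashi2003.thm41_signedCharIdeal_divisibility)
    (h5 : realPeriodRat_eq_unit_mul_plusPeriod) (h3 : realPeriodRat_eq_unit_mul_plusPeriod_three)
    (hL20 : Wuthrich2014.lemma20_surjective_threeAdic_of_semistable)
    (hGZK : rank_eq_analyticRank_of_analyticRank_le_one) (hmod : hasEntireLFunction_rat)
    (hA5 : corA5_pPart_of_signedCharIdeal_eq)
    (hp : p ≠ 2) (hX : ClassX7 W p) (hap : W.frobeniusTrace p = 0) (hs : Surj W p)
    (h1 : W.analyticRank = 1)
    [NeZero (W.conductorNorm ℤ)] {f₀ : CuspForm (Gamma0 (W.conductorNorm ℤ)) 2} (hf₀ : IsNewformOf W f₀)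
    {n : ℕ} (hn : Even n) {Θ : IwasawaAlgebra p}
    (hΘ : iwasawaToPowerSeries p Θ =
      ((mazurTateElement f₀ p n).map (algebraMap ℚ ℚ_[p]) : PowerSeries ℚ_[p]))
    (hΘ0 : Θ ≠ 0) (hμ : mu Θ = 0) (hlam : lam Θ = (cyclotomicOmegaMinus p n).natDegree + 1)
    (hlt : lam Θ < p ^ n) : BSDp W p :=
  _root_.Summit.BirchSwinnertonDyer.Rank1Residual.Supersingular.bsdp_of_mazurTate_even_of_corA5_of_analyticRank_eq_one
    W p h12 h41 h5 h3 hL20 hGZK hmod hA5 hp hX.1.1 hap hs h1 hf₀ hn hΘ hΘ0 hμ hlam hlt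

/-- **X7 ∧ `r_an = 1` ∧ odd `p` ∧ `a_p = 0` ∧ surj(p): `BSD(E,p)` from the λ-certificate
`(μ, λ)(L_p^ε) = (0, 1)`** (for every signed `p`-adic `L`-function of every newform of `E`, as in
`X7.kobayashiMainConjecture_of_lam_eq_one_of_analyticRank_eq_one`, p213197), every other input a
named fact (the displayed `hBKO` of `X7.bsdp_of_lam_eq_one_of_bkoLink_…` supplied by the Cor. A.5
reading-fact). PER PAIR; nothing booked. [cite: BurungaleKobayashiOta2023, App. A Cor. A.5]
[cite: Kobayashi2003, Thm. 7.4, Thm. 1.2, Thm. 4.1 and Conjecture (p. 2)] [cite: Wuthrich2014, Lemma 20 (p. 399)]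
[cite: Miller2011LMS, §1 and Def. 1.1] -/
theorem X7.bsdp_of_lam_eq_one_of_corA5_of_analyticRank_eq_one
    (h12 : Kobayashi2003.thm12_signedSelmerDual_finite_torsion)
    (h41 : Kobayashi2003.thm41_signedCharIdeal_divisibility)
    (h5 : realPeriodRat_eq_unit_mul_plusPeriod) (h3 : realPeriodRat_eq_unit_mul_plusPeriod_three)
    (hL20 : Wuthrich2014.lemma20_surjective_threeAdic_of_semistable)
    (hGZK : rank_eq_analyticRank_of_analyticRank_le_one) (hmod : hasEntireLFunction_rat)
    (hA5 : corA5_pPart_of_signedCharIdeal_eq)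
    (hp : p ≠ 2) (hX : ClassX7 W p) (hap : W.frobeniusTrace p = 0) (hs : Surj W p)
    (h1 : W.analyticRank = 1) (ε : ℤˣ)
    (hcert : ∀ {N : ℕ} [NeZero N] (f : CuspForm (Gamma0 N) 2), IsNewformOf W f →
      ∀ L : IwasawaAlgebra p, IsSignedPAdicLFunction f p ε L → mu L = 0 ∧ lam L = 1) : BSDp W p :=
  X7.bsdp_of_lam_eq_one_of_bkoLink_of_analyticRank_eq_one W p h12 h41 h5 h3 hL20 hGZK hp hX hap hs h1 ε hcert
    (missingPPartAt_of_kobayashiMainConjecture_of_corA5 W p hA5 hmod hGZK hp hX.1.1 hap h1 ε)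

/-- **X6 ∧ `r_an = 1` ∧ odd `p`: `BSD(E,p)` from the λ-certificate `(μ, λ)(L_p^ε) = (0, 1)`**, every
other input a named fact — `a_p = 0` (`ClassX6.frobeniusTrace_eq_zero`) and surjectivity of `ρ̄_{E,p}`
(`ClassX6.surj`: semistable + irreducible, Serre Prop. 21) AUTOMATIC on class X6 at an odd prime;
`X6.kobayashiMainConjecture_of_lam_eq_one_of_analyticRank_eq_one` (p213197) ∘ the Cor. A.5
reading-fact. A second per-pair route beside JSW 2017 Thm. 1.2.1 (flag `JSW-ss`) and prover A's Kim
rank-one Kurihara twin at `p ≥ 5` (p218800); this one needs neither the flag nor `p ≥ 5`. PER PAIR;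
nothing booked. [cite: BurungaleKobayashiOta2023, App. A Cor. A.5] [cite: Kobayashi2003, Thm. 7.4, Thm. 1.2, Thm. 4.1 and Conjecture (p. 2)]
[cite: Serre1972, §5.4 Prop. 21 i)] [cite: Miller2011LMS, §1 and Def. 1.1] -/
theorem X6.bsdp_of_lam_eq_one_of_corA5_of_analyticRank_eq_one
    (h12 : Kobayashi2003.thm12_signedSelmerDual_finite_torsion)
    (h41 : Kobayashi2003.thm41_signedCharIdeal_divisibility)
    (h5 : realPeriodRat_eq_unit_mul_plusPeriod) (h3 : realPeriodRat_eq_unit_mul_plusPeriod_three)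
    (hL20 : Wuthrich2014.lemma20_surjective_threeAdic_of_semistable)
    (hGZK : rank_eq_analyticRank_of_analyticRank_le_one) (hmod : hasEntireLFunction_rat)
    (hA5 : corA5_pPart_of_signedCharIdeal_eq)
    (hp : p ≠ 2) (hX : ClassX6 W p) (h1 : W.analyticRank = 1) (ε : ℤˣ)
    (hcert : ∀ {N : ℕ} [NeZero N] (f : CuspForm (Gamma0 N) 2), IsNewformOf W f →
      ∀ L : IwasawaAlgebra p, IsSignedPAdicLFunction f p ε L → mu L = 0 ∧ lam L = 1) : BSDp W p :=
  bsdp_of_missingPPartAt W p hGZK h1.le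
    (missingPPartAt_of_kobayashiMainConjecture_of_corA5 W p hA5 hmod hGZK hp hX.1.1
      (ClassX6.frobeniusTrace_eq_zero W p hp hX) h1 ε
      (X6.kobayashiMainConjecture_of_lam_eq_one_of_analyticRank_eq_one W p h12 h41 h5 h3 hL20 hGZK hp hX
        h1 ε hcert))

end PerPair

end Summit.BirchSwinnertonDyer.Rank1Residual.Supersingular

end
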